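import Summits.RiemannHypothesis.RiemannHypothesis.Theorems.TiltedLandingLaw421R3Lens1ArcSignD

/-!
# TiltedLandingLaw421R3 — lens-1: RUNG 2 of the arc-sign ladder PROVED — `pinning_of_noAscendingArc : PinningOfNoAscendingArc` (part E)

LENS-1 gen-6 module image `rh33346-cover/lens-1/ArcSignE-v1.lean` (landing target `…/Theorems/TiltedLandingLaw421R3Lens1ArcSignE.lean`; single import =
part D; namespace `RhW08.Lens1ArcSign`; 0 `sorry`, no instances / notation; checked BY CHAIN over the ArcSign A–D images until tree).

RUNG 2 (memo `O6b-MULTIARC-MEMO-v1.md`, NODE v14 P8-R2, statement `PinningOfNoAscendingArc` of part C): on a legal frame, an upper zero `a` of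
`f^{(j)}` whose small Jensen circles `|w − Re a| = Im a + δ` carry NO ASCENDING BAD ARC satisfies the literal `TopPinning` disjunction — a non-real
zero of `f^{(j+1)}` in the CLOSED Jensen disc (`NestedStep`) or an NL event of level `j` in the CLOSED base.  Any `m̃`, any number of crossing
mates; RUNG 1 (`pinning_of_arcSignClear`) is the case of no bad arc (`rung1_of_rung2`).

PROOF.  §6 `disc_census_ge`: for `f` entire and real, zero-free with `f′` on the circle, and no ascending bad piece of `(f′/f) ∘ circleLoop` on
`[0, ½]`: `2 (N_D(f′) − N_D(f)) = sgn (f′/f)(c − r) − sgn (f′/f)(c + r) + n`, `n ∈ ℕ` (argument principle `wind_circleLoop_eq_zeroCountC` + the loop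
inequality `two_mul_wind_ge` of part D; the conjugation symmetry of the loop from `apply_conj_eq_conj`, the finiteness of its real points from
`breaks_finite_or_flat`).  §7 `no_nonreal_zero_of_disc_ge`: with that census, all critical points in the disc real and the real Rolle identity
on the base, every zero of `f` in the disc is real (the surplus `n ≥ 0` only helps).  §8 ★★★ `pinning_of_noAscendingArc`: as RUNG 1 — NL margin,
child margin, a GENERIC `δ` whose whole circle misses the finitely many zeros of `f^{(j)} f^{(j+1)}` in the box, `LocalB` or an NL event
(`nlEventOf_of_not_localB`), `rolleIdentity_of_localB_core`, and `a` itself is a non-real zero in the disc — contradiction.  The degenerate frame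
`f^{(j)} ≡ 0` (not excluded by the hypothesis) is settled by the child `w = a`.  COROLLARY `topPinning_of_ascResidual : TopPinningAscResidual →
TopPinning` — after RUNG 2 the law's only open population is «an ascending bad arc on arbitrarily small circles».

HONEST LABEL: RUNG 2 is argument-principle bookkeeping on the hypothesis `ArcNoAsc`; it does NOT prove `TopPinning`: `TopPinningAscResidual`,
`TopPinningArcResidual`, `TopPinning`, `TopPinningCrossing`, `RegUmbrella11S`, 33346, 33347 are OPEN; nothing here bears on the truth of RH; RH is
not proved; checked ≠ proved.
-/

noncomputable section

namespace RhW08.Lens1ArcSign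

open Complex Set Metric Filter Topology
open scoped Real
open Literature.Topology.PlaneTopology Literature.Analysis.Complex
open Summit.RiemannHypothesis.RiemannHypothesis.Theorems.Splittings.JensenWindow
open RhIdea6.G17.W07C7 RhIdea6.G17.W07C7.Rev6 RhIdea6.G18.W07C8.Law421BirthS RhIdea6.G19.W07C11.Seam
open RhIdea6.G20.W07C12.Frac RhIdea6.G20.W07C12.StColP RhW07.C12.FieldSplit RhIdea6.G21.W07C13.TentMax
open RhW07.C14.TwoSided RhW07.C14.Classes RhW07.C14.Lineage RhW07.C14.Booking
open RhW07.C13.Heredity RhIdea6.G22.W07C15pre.Injection RhW07.E3.Cell RhW07.E3.Lit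
open RhW08.Round1 RhW08.StSwap RhW08.Round2 RhW08.QuadW RhW08.SealSwapQ RhW08.SealSwap RhW08.SuccB RhW08.SuccSplit
open RhW08.SuccTheft RhW08.Column RhW08.Hurwitz RhW08.ClusterQ RhW08.ClusterQM RhW08.NewtonDoor RhW08.NewtonDoorGenusOne RhW08.PurseP
open RhW08.Lens1SignCut RhW08.Lens1Coverage RhW08.IsolatedTilt RhW08.Lens1Pinning RhW08.Lens1PinningIso

variable {f : ℂ → ℂ}

/-! ## §6 The census inequality on a disc -/

/-- ★★ CENSUS INEQUALITY ON A DISC.  `f` entire and real, `f f′ ≠ 0` on the circle `‖w − c‖ = r` (`r > 0`), and no ascending bad piece of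
`(f′/f) ∘ circleLoop c r` on `[0, ½]` ⇒ `2 (N_D(f′) − N_D(f)) = sgn (f′/f)(c − r) − sgn (f′/f)(c + r) + n` with `n ∈ ℕ`.  (The `m̃ = 0` census
`disc_census` is the case of no bad piece; `n/2 = #desc − #asc`.) -/
theorem disc_census_ge (hfd : Differentiable ℂ f) (hreal : ∀ x : ℝ, (f x).im = 0) {c r : ℝ} (hr : 0 < r)
    (hf0 : ∀ u : ℂ, ‖u - c‖ = r → f u ≠ 0) (hd0 : ∀ u : ℂ, ‖u - c‖ = r → deriv f u ≠ 0)
    (hna : ∀ t₁ t₂ : ℝ, 0 ≤ t₁ → t₁ < t₂ → t₂ ≤ 1 / 2 →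
      (∀ t ∈ Ioo t₁ t₂, 0 < (deriv f (circleLoop (c : ℂ) r t) / f (circleLoop (c : ℂ) r t)).im) →
      (deriv f (circleLoop (c : ℂ) r t₁) / f (circleLoop (c : ℂ) r t₁)).im = 0 →
      (deriv f (circleLoop (c : ℂ) r t₂) / f (circleLoop (c : ℂ) r t₂)).im = 0 →
      ¬ ((deriv f (circleLoop (c : ℂ) r t₁) / f (circleLoop (c : ℂ) r t₁)).re < 0 ∧
          0 < (deriv f (circleLoop (c : ℂ) r t₂) / f (circleLoop (c : ℂ) r t₂)).re)) :
    ∃ n : ℕ, 2 * (zeroCountC (deriv f) (ball (c : ℂ) r) - zeroCountC f (ball (c : ℂ) r)) =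
      sgn (deriv f ((c - r : ℝ) : ℂ) / f ((c - r : ℝ) : ℂ)).re - sgn (deriv f ((c + r : ℝ) : ℂ) / f ((c + r : ℝ) : ℂ)).re + n := by
  have hγr : ∀ t : ℝ, ‖circleLoop (c : ℂ) r t - c‖ = r := fun t => by rw [norm_circleLoop_sub_center, abs_of_pos hr]
  have hcf : Continuous fun t : ℝ => f (circleLoop (c : ℂ) r t) := hfd.continuous.comp (continuous_circleLoop _ _)
  have hcd : Continuous fun t : ℝ => deriv f (circleLoop (c : ℂ) r t) := hfd.deriv.continuous.comp (continuous_circleLoop _ _)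
  have hF : IsNonvanishingLoop (fun t => f (circleLoop (c : ℂ) r t)) :=
    ⟨hcf.continuousOn, fun t _ => hf0 _ (hγr t), by simp only [circleLoop_zero_eq]⟩
  have hF' : IsNonvanishingLoop (fun t => deriv f (circleLoop (c : ℂ) r t)) :=
    ⟨hcd.continuousOn, fun t _ => hd0 _ (hγr t), by simp only [circleLoop_zero_eq]⟩
  have hdiv : wind (fun t => deriv f (circleLoop (c : ℂ) r t) / f (circleLoop (c : ℂ) r t)) =
      wind (fun t => deriv f (circleLoop (c : ℂ) r t)) - wind (fun t => f (circleLoop (c : ℂ) r t)) := wind_div hF' hF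
  have hWf := wind_circleLoop_eq_zeroCountC hfd hr hf0
  have hWd := wind_circleLoop_eq_zeroCountC hfd.deriv hr hd0
  have hΓc : ContinuousOn (fun t => deriv f (circleLoop (c : ℂ) r t) / f (circleLoop (c : ℂ) r t)) (Icc 0 1) :=
    hcd.continuousOn.div hcf.continuousOn fun t _ => hf0 _ (hγr t)
  have h01 : deriv f (circleLoop (c : ℂ) r 0) / f (circleLoop (c : ℂ) r 0) =
      deriv f (circleLoop (c : ℂ) r 1) / f (circleLoop (c : ℂ) r 1) := by rw [circleLoop_zero_eq]
  have hne : ∀ t ∈ Icc (0 : ℝ) 1, deriv f (circleLoop (c : ℂ) r t) / f (circleLoop (c : ℂ) r t) ≠ 0 :=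
    fun t _ => div_ne_zero (hd0 _ (hγr t)) (hf0 _ (hγr t))
  have hfreal : ∀ z : ℂ, f ((starRingEnd ℂ) z) = (starRingEnd ℂ) (f z) := apply_conj_eq_conj hfd hreal
  have hdreal : ∀ x : ℝ, (deriv f x).im = 0 := im_deriv_ofReal hfd hreal
  have hd'real : ∀ z : ℂ, deriv f ((starRingEnd ℂ) z) = (starRingEnd ℂ) (deriv f z) := apply_conj_eq_conj hfd.deriv hdreal
  have hsym : ∀ t ∈ Icc (0 : ℝ) 1, deriv f (circleLoop (c : ℂ) r (1 - t)) / f (circleLoop (c : ℂ) r (1 - t)) =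
      (starRingEnd ℂ) (deriv f (circleLoop (c : ℂ) r t) / f (circleLoop (c : ℂ) r t)) := by
    intro t _
    rw [circleLoop_one_sub, hd'real, hfreal, map_div₀]
  have hZ := breaks_finite_or_flat hfd (c := c) (r := r) (fun t => hf0 _ (hγr t))
  obtain ⟨n, hn⟩ := two_mul_wind_ge hΓc h01 hne hsym hZ hna
  refine ⟨n, ?_⟩
  rw [circleLoop_ofReal_half, circleLoop_ofReal_zero, hdiv, Int.cast_sub, hWd, hWf] at hn
  exact hn

/-! ## §7 Disc Rolle closure with surplus -/

/-- ★ DISC ROLLE CLOSURE WITH SURPLUS (twin of `no_nonreal_zero_of_disc`).  If the disc census holds with a surplus `n ∈ ℕ`, every critical point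
in the open disc is real and the real Rolle identity holds on the base, then every zero of `f` in the disc is real (and `n = 0`). -/
theorem no_nonreal_zero_of_disc_ge (hfd : Differentiable ℂ f) {c r : ℝ} (hr : 0 < r)
    (hfl : f ((c - r : ℝ) : ℂ) ≠ 0) (hfr : f ((c + r : ℝ) : ℂ) ≠ 0)
    (hdl : deriv f ((c - r : ℝ) : ℂ) ≠ 0) (hdr : deriv f ((c + r : ℝ) : ℂ) ≠ 0)
    (hf0 : ∀ u : ℂ, ‖u - c‖ = r → f u ≠ 0) {n : ℕ}
    (hc : 2 * (zeroCountC (deriv f) (ball (c : ℂ) r) - zeroCountC f (ball (c : ℂ) r)) =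
      sgn (deriv f ((c - r : ℝ) : ℂ) / f ((c - r : ℝ) : ℂ)).re - sgn (deriv f ((c + r : ℝ) : ℂ) / f ((c + r : ℝ) : ℂ)).re + n)
    (hA : ∀ ρ ∈ ball (c : ℂ) r, deriv f ρ = 0 → ρ.im = 0) (hR : RolleIdentity f (c - r) (c + r) r) :
    ∀ ρ ∈ ball (c : ℂ) r, f ρ = 0 → ρ.im = 0 := by
  classical
  have hW : SWindow f (fun _ => True) (c - r) (c + r) r :=
    ⟨by linarith, hr, fun _ _ => trivial, fun _ _ => trivial, fun _ _ _ => trivial, fun _ _ _ => trivial, hfl, hfr, hdl, hdr⟩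
  set K : Set ℂ := ball (c : ℂ) r with hKdef
  have hfin : {ρ : ℂ | f ρ = 0 ∧ ρ ∈ K}.Finite := by
    refine (Rouche.finite_zeros f hr (by linarith : r < r + 1) hfd.differentiableOn hf0).subset ?_
    rintro ρ ⟨h0, hρ⟩
    exact ⟨ball_subset_closedBall hρ, h0⟩
  have e1 : {ρ : ℂ | deriv f ρ = 0 ∧ ρ ∈ K} = {ρ : ℂ | deriv f ρ = 0 ∧ ρ ∈ K ∩ {ρ | ρ.im = 0}} := by
    ext ρ
    simp only [mem_setOf_eq, mem_inter_iff]
    constructor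
    · rintro ⟨h0, hK⟩; exact ⟨h0, hK, hA ρ hK h0⟩
    · rintro ⟨h0, hK, -⟩; exact ⟨h0, hK⟩
  have e1' : zeroCountC (deriv f) K = zeroCountC (deriv f) (K ∩ {ρ | ρ.im = 0}) := by
    unfold zeroCountC; rw [e1]
  set B : Set ℂ := {ρ : ℂ | f ρ = 0 ∧ ρ ∈ K ∧ ρ.im ≠ 0} with hBdef
  have e2 : {ρ : ℂ | f ρ = 0 ∧ ρ ∈ K} = {ρ : ℂ | f ρ = 0 ∧ ρ ∈ K ∩ {ρ | ρ.im = 0}} ∪ B := by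
    ext ρ
    simp only [mem_setOf_eq, mem_inter_iff, mem_union, hBdef]
    constructor
    · rintro ⟨h0, hK⟩
      by_cases him : ρ.im = 0
      · exact Or.inl ⟨h0, hK, him⟩
      · exact Or.inr ⟨h0, hK, him⟩
    · rintro (⟨h0, hK, -⟩ | ⟨h0, hK, -⟩) <;> exact ⟨h0, hK⟩
  have hdisj : Disjoint {ρ : ℂ | f ρ = 0 ∧ ρ ∈ K ∩ {ρ | ρ.im = 0}} B := by
    rw [Set.disjoint_left]
    rintro ρ ⟨-, -, him⟩ ⟨-, -, him'⟩
    exact him' him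
  have hAfin : {ρ : ℂ | f ρ = 0 ∧ ρ ∈ K ∩ {ρ | ρ.im = 0}}.Finite := hfin.subset fun ρ hρ => ⟨hρ.1, hρ.2.1⟩
  have hBfin : B.Finite := hfin.subset fun ρ hρ => ⟨hρ.1, hρ.2.1⟩
  have e2' : zeroCountC f K = zeroCountC f (K ∩ {ρ | ρ.im = 0}) + ∑ᶠ ρ ∈ B, ((meromorphicOrderAt f ρ).untop₀ : ℂ) := by
    unfold zeroCountC; rw [e2, finsum_mem_union hdisj hAfin hBfin]
  have hB0 : 2 * ∑ᶠ ρ ∈ B, ((meromorphicOrderAt f ρ).untop₀ : ℂ) + n = 0 := by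
    rw [e1', e2'] at hc
    unfold RolleIdentity at hR
    rw [zeroCountC_box_real_eq, zeroCountC_box_real_eq] at hR
    linear_combination hR - hc
  rw [finsum_mem_eq_finite_toFinset_sum _ hBfin, ← Int.cast_sum] at hB0
  have hB0' : 2 * ∑ ρ ∈ hBfin.toFinset, (meromorphicOrderAt f ρ).untop₀ + (n : ℤ) = 0 := by exact_mod_cast hB0
  have hpos : ∀ ρ ∈ hBfin.toFinset, 0 < (meromorphicOrderAt f ρ).untop₀ := by
    intro ρ hρ
    rw [Set.Finite.mem_toFinset] at hρ
    exact order_pos hfd hW (ball_subset_box c r hρ.2.1) hρ.1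
  intro ρ hρK hρ0
  by_contra him
  have hρB : ρ ∈ hBfin.toFinset := by
    rw [Set.Finite.mem_toFinset]; exact ⟨hρ0, hρK, him⟩
  have h1 := Finset.single_le_sum (fun ρ hρ => (hpos ρ hρ).le) hρB
  have h2 := hpos ρ hρB
  omega

/-! ## §8 RUNG 2 -/

/-- `ArcNoAscCofinite f j a`: no ascending bad arc on the circles `|w − Re a| = Im a + δ` for all `δ ∈ (0, d₀)` outside a FINITE exceptional
set (tangencies, non-generic radii) — the form the instrument measures; it implies the same conclusion (the proof uses one generic `δ`). -/
def ArcNoAscCofinite (f : ℂ → ℂ) (j : ℕ) (a : ℂ) : Prop :=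
  ∃ d0 > 0, ∃ E : Set ℝ, E.Finite ∧ ∀ δ ∈ Ioo 0 d0 \ E, NoAscendingArc f j a δ

/-- `ArcNoAsc ⇒ ArcNoAscCofinite` (empty exceptional set). -/
theorem arcNoAscCofinite_of_arcNoAsc {f : ℂ → ℂ} {j : ℕ} {a : ℂ} (h : ArcNoAsc f j a) : ArcNoAscCofinite f j a := by
  obtain ⟨d0, hd0, hna⟩ := h
  exact ⟨d0, hd0, ∅, Set.finite_empty, fun δ hδ => hna δ hδ.1⟩

/-- ★★★ RUNG 2 — PINNING FROM «NO ASCENDING BAD ARC» (cofinite form; any `m̃`).  On a legal frame, an upper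
zero `a` of `f^{(j)}` all of whose small Jensen circles `|w − Re a| = Im a + δ` (`0 < δ < d₀`) carry no ascending bad arc has a NON-REAL zero of
`f^{(j+1)}` in its CLOSED Jensen disc or an NL event of level `j` in the CLOSED base.  [Walsh, Ann. of Math. 22 (1920) §4 on `a`ʼs own circle,
partitioned at the real points of `f^{(j+1)}/f^{(j)}`; memo O6b §2 (PIN) `ch = 1 + pz − #asc + #desc`.] -/
theorem pinning_of_noAscendingArc_cofinite {η : ℝ} {f : ℂ → ℂ} {x₀ s hmax R Hs : ℝ} {B : ℕ} (hE : EngineHyps5 2 η f x₀ s hmax R Hs B)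
    {j : ℕ} {a : ℂ} (ha : iteratedDeriv j f a = 0) (hapos : 0 < a.im) (hNA : ArcNoAscCofinite f j a) :
    (∃ w : ℂ, iteratedDeriv (j + 1) f w = 0 ∧ w.im ≠ 0 ∧ NestedStep a w) ∨ (∃ x : ℝ, |x - a.re| ≤ a.im ∧ NLEventOf f j x) := by
  classical
  have hf : RealEntireLt2 f := realEntireLt2_of_hyps hE
  -- degenerate frame `f^{(j)} ≡ 0`: `a` itself is a child
  by_cases hnz : iteratedDeriv j f = 0
  · left
    refine ⟨a, ?_, hapos.ne', ?_⟩
    · rw [iteratedDeriv_succ, hnz]; simp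
    · show (a.re - a.re) ^ 2 + a.im ^ 2 ≤ a.im ^ 2
      simp
  set G : ℂ → ℂ := iteratedDeriv j f with hGdef
  have hG : RealEntireLt2 G :=
    { diff := differentiable_iteratedDeriv_of_entire hf.diff j
      growth := by
        obtain ⟨ρ, C, hρ0, hρ, hgr⟩ := hf.growth
        obtain ⟨ρ', C', h1, h2, h3⟩ := exists_growth_iteratedDeriv hf.diff hρ0 hρ hgr j
        exact ⟨ρ', C', h1, h2, h3⟩
      real := im_iteratedDeriv_ofReal hf.diff hf.real j }
  have e1 : deriv G = iteratedDeriv (j + 1) f := by rw [hGdef, ← iteratedDeriv_succ]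
  have hHs : 0 ≤ Hs := hE.2.2.2.2.2.2.2.1
  have hG'ne : iteratedDeriv (j + 1) f ≠ 0 := iteratedDeriv_succ_ne_zero_of_zero hf.diff j hnz ha
  have hG'd : Differentiable ℂ (iteratedDeriv (j + 1) f) := differentiable_iteratedDeriv_of_entire hf.diff (j + 1)
  obtain ⟨d0, hd0, E, hEfin, hna⟩ := hNA
  by_contra hcon
  push Not at hcon
  obtain ⟨hnoC, hnoNL⟩ := hcon
  obtain ⟨m, hm0, hm1, hmarg⟩ := exists_nl_margin hf hG'ne hapos (a := a)
  obtain ⟨m', hm'0, hm'1, hchild⟩ := exists_child_margin hE hG'ne hapos (a := a)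
  set δ₀ : ℝ := min d0 (min m m') with hδ₀
  have hδ₀0 : 0 < δ₀ := lt_min hd0 (lt_min hm0 hm'0)
  -- a GENERIC `δ ∈ (0, δ₀)`: the whole circle of radius `Im a + δ` misses the finitely many zeros of `G`, `G′` in the box
  set L : ℝ := a.im + Hs + 2 with hL
  have hz₀ : ((a.re : ℂ)) ∈ Ioo (a.re - L) (a.re + L) ×ℂ Ioo (-(Hs + 1)) (Hs + 1) :=
    ofReal_mem_box (by rw [sub_self, abs_zero]; linarith) hHs
  set Z : Set ℂ := {ρ : ℂ | G ρ = 0 ∧ ρ ∈ Ioo (a.re - L) (a.re + L) ×ℂ Ioo (-(Hs + 1)) (Hs + 1)} ∪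
    {ρ : ℂ | iteratedDeriv (j + 1) f ρ = 0 ∧ ρ ∈ Ioo (a.re - L) (a.re + L) ×ℂ Ioo (-(Hs + 1)) (Hs + 1)} with hZ
  have hZfin : Z.Finite := (finite_zeros_box hG.diff hnz hz₀).union (finite_zeros_box hG'd hG'ne hz₀)
  have hbad : ((fun ρ : ℂ => ‖ρ - (a.re : ℂ)‖ - a.im) '' Z ∪ E).Finite := (hZfin.image _).union hEfin
  obtain ⟨δ, hδI, hδbad⟩ := ((Set.Ioo_infinite hδ₀0).sdiff hbad).nonempty
  obtain ⟨hδ0, hδ1⟩ := hδI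
  have hδd0 : δ < d0 := lt_of_lt_of_le hδ1 (min_le_left _ _)
  have hδm : δ < m := lt_of_lt_of_le hδ1 ((min_le_right _ _).trans (min_le_left _ _))
  have hδm' : δ < m' := lt_of_lt_of_le hδ1 ((min_le_right _ _).trans (min_le_right _ _))
  have hr : 0 < a.im + δ := by linarith
  have haHs : |a.im| ≤ Hs := abs_im_le_of_level hE hnz ha
  rw [abs_of_pos hapos] at haHs
  -- the circle lies in the box
  have hbox : ∀ u : ℂ, ‖u - (a.re : ℂ)‖ = a.im + δ → u ∈ Ioo (a.re - L) (a.re + L) ×ℂ Ioo (-(Hs + 1)) (Hs + 1) := by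
    intro u hu
    have h1 := abs_re_le_norm (u - (a.re : ℂ))
    have h2 := abs_im_le_norm (u - (a.re : ℂ))
    rw [hu] at h1 h2
    rw [sub_re, ofReal_re, abs_le] at h1
    rw [sub_im, ofReal_im, sub_zero, abs_le] at h2
    exact mem_reProdIm.2 ⟨⟨by linarith [h1.1], by linarith [h1.2]⟩, ⟨by linarith [h2.1], by linarith [h2.2]⟩⟩
  have hG0 : ∀ u : ℂ, ‖u - ((a.re : ℝ) : ℂ)‖ = a.im + δ → G u ≠ 0 := fun u hu h0 =>
    hδbad (Or.inl ⟨u, Or.inl ⟨h0, hbox u hu⟩, by simp only [hu]; ring⟩)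
  have hG'0 : ∀ u : ℂ, ‖u - ((a.re : ℝ) : ℂ)‖ = a.im + δ → iteratedDeriv (j + 1) f u ≠ 0 := fun u hu h0 =>
    hδbad (Or.inl ⟨u, Or.inr ⟨h0, hbox u hu⟩, by simp only [hu]; ring⟩)
  have hδE : δ ∉ E := fun h => hδbad (Or.inr h)
  have hdG0 : ∀ u : ℂ, ‖u - ((a.re : ℝ) : ℂ)‖ = a.im + δ → deriv G u ≠ 0 := by rw [e1]; exact hG'0
  -- the feet
  have hβ : ‖((a.re + (a.im + δ) : ℝ) : ℂ) - ((a.re : ℝ) : ℂ)‖ = a.im + δ := by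
    rw [← ofReal_sub, show a.re + (a.im + δ) - a.re = a.im + δ by ring, Complex.norm_real, Real.norm_eq_abs, abs_of_pos hr]
  have hα : ‖((a.re - (a.im + δ) : ℝ) : ℂ) - ((a.re : ℝ) : ℂ)‖ = a.im + δ := by
    rw [← ofReal_sub, show a.re - (a.im + δ) - a.re = -(a.im + δ) by ring, Complex.norm_real, Real.norm_eq_abs, abs_neg,
      abs_of_pos hr]
  have hGβ : G ((a.re + (a.im + δ) : ℝ) : ℂ) ≠ 0 := hG0 _ hβ
  have hGα : G ((a.re - (a.im + δ) : ℝ) : ℂ) ≠ 0 := hG0 _ hα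
  have hdGβ : deriv G ((a.re + (a.im + δ) : ℝ) : ℂ) ≠ 0 := hdG0 _ hβ
  have hdGα : deriv G ((a.re - (a.im + δ) : ℝ) : ℂ) ≠ 0 := hdG0 _ hα
  -- the base: local Laguerre law B, or an NL event within the margin
  by_cases hB : LocalB G (a.re - (a.im + δ)) (a.re + (a.im + δ))
  swap
  · obtain ⟨x, hx, hNL⟩ := nlEventOf_of_not_localB hf j hB
    have hxa : |x - a.re| < a.im + m := by rw [abs_lt]; constructor <;> linarith [hx.1, hx.2]
    exact hnoNL x (hmarg x hNL hxa) hNL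
  have hW : SWindow G (fun _ => True) (a.re - (a.im + δ)) (a.re + (a.im + δ)) (a.im + δ) :=
    ⟨by linarith, hr, fun _ _ => trivial, fun _ _ => trivial, fun _ _ _ => trivial, fun _ _ _ => trivial, hGα, hGβ, hdGα, hdGβ⟩
  have hRolle : RolleIdentity G (a.re - (a.im + δ)) (a.re + (a.im + δ)) (a.im + δ) :=
    rolleIdentity_of_localB_core hG.diff hG.real hW hB
  -- every critical point in the open disc is real — else it is a `NestedStep` child (excluded)
  have hA : ∀ ρ ∈ ball ((a.re : ℝ) : ℂ) (a.im + δ), deriv G ρ = 0 → ρ.im = 0 := by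
    intro ρ hρ hdρ
    by_contra hρim
    have hρ' : ‖ρ - (a.re : ℂ)‖ < a.im + m' := by
      rw [mem_ball, dist_eq_norm] at hρ; linarith
    have hdρ' : iteratedDeriv (j + 1) f ρ = 0 := by rw [← e1]; exact hdρ
    exact hnoC ρ hdρ' hρim (hchild ρ hdρ' hρim hρ')
  -- the census with surplus on the circle (no ascending bad arc at this `δ`), and the disc Rolle closure: `a` is a non-real zero
  obtain ⟨n, hc⟩ := disc_census_ge hG.diff hG.real hr hG0 hdG0 (hna δ ⟨⟨hδ0, hδd0⟩, hδE⟩)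
  have hall := no_nonreal_zero_of_disc_ge hG.diff hr hGα hGβ hdGα hdGβ hG0 hc hA hRolle
  have haball : a ∈ ball ((a.re : ℝ) : ℂ) (a.im + δ) := by
    rw [mem_ball, dist_eq_norm]
    have e : a - (a.re : ℂ) = ((a.im : ℝ) : ℂ) * I := Complex.ext (by simp) (by simp)
    rw [e, norm_mul, Complex.norm_real, Complex.norm_I, mul_one, Real.norm_eq_abs, abs_of_pos hapos]
    linarith
  exact absurd (hall a haball ha) hapos.ne'

/-- ★★★ RUNG 2 (`PinningOfNoAscendingArc`, the statement typed in part C): pinning from «no ascending bad arc on all small circles». -/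
theorem pinning_of_noAscendingArc : PinningOfNoAscendingArc :=
  fun _ _ _ _ _ _ _ _ hE _ _ ha hapos hNA => pinning_of_noAscendingArc_cofinite hE ha hapos (arcNoAscCofinite_of_arcNoAsc hNA)

/-- ★ After RUNG 2 the law reduces to its ascending residual: `TopPinningAscResidual → TopPinning`. -/
theorem topPinning_of_ascResidual (h3 : TopPinningAscResidual) : TopPinning :=
  topPinning_of_rung2 pinning_of_noAscendingArc h3

/-- ★ … and `TopPinningCrossing` likewise. -/
theorem topPinningCrossing_of_ascResidual (h3 : TopPinningAscResidual) : TopPinningCrossing :=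
  topPinningCrossing_of_arcResidual (arcResidual_of_rung2 pinning_of_noAscendingArc h3)

end RhW08.Lens1ArcSign
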